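import Mathlib.Data.Nat.Choose.Basic
import Mathlib.Algebra.BigOperators.Intervals
import Mathlib.Algebra.Order.BigOperators.Group.Finset
import Mathlib.Tactic
import Summits.CriticalPhenomena.PercolationContinuityZ3.Theorems.PercNearOneGluingNoHeavyLowerTailCoreBlock
import HarnessLib

/-!
# Λ-monotonicity: the normalised block moment `Mo(h) / ((2h-n)·C(n,h))` decreases away from the centre

Support file for the Sahi / Conjecture-P programme of route `PercNearOneGluingNoHeavy`
(`--supports stmt-CriticalPhenomena-4575`, prover prim-l12-p5 gen 28; proof note
`prim-l12-p5/U-PROOF-g28.md` §2, Lemma B1).  No definitions, no named facts, no sorries.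

Setting (tree `CoreBlock` notation): a block of `M` fair coins with a symmetric unimodal weight `w ≥ 0` on its
head count `x`, an own buffer of `L` fair coins, `n = M + L`, and at total head count `h`
`F(h) = ∑_x C(M,x) C(L,h-x) w(x)`, `Mo(h) = ∑_x C(M,x) C(L,h-x) w(x) (2x-M)`.
The quantity `Λ(h) = Mo(h) / ((2h-n) C(n,h))` is `E[d·w(x) | total magnetisation s] / (s · P-normalisation)`,
`d = 2x-M`, `s = 2h-n`: the tilted first moment of the block per unit of total magnetisation.

* `Mo_pascal`, `Mo_centre`, `Mo_base` : Pascal recursion in the buffer, vanishing at the centre, the case `L = 0`;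
* `weight_identity` : `(2h-n)C(n,h) + (2h-n-2)C(n,h-1) = n/(n+1) · (2h-n-1) · C(n+1,h)` — the coefficients of the
  recursion `Λ_{L+1}(h) = β Λ_L(h) + α Λ_L(h-1)` sum to the CONSTANT `n/(n+1)`;
* `lam_step` (**Lemma B1**) : for `n < 2h`, `h+1 ≤ n`:  `Λ(h+1) ≤ Λ(h)` — by induction on `L` (base: `Λ = w(h)`,
  unimodality; step: the recursion and the constant coefficient sum).
This is the key new input of the complete proof of CONJECTURE U (note §1): it makes `Λ` a mixture of centred
windows in the total magnetisation, so that the buffer can be merged into the second block.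
-/

namespace Summit.CriticalPhenomena.PercolationContinuityZ3.Theorems

namespace LambdaMono

open Finset

variable (M : ℕ) (w : ℕ → ℝ)

/-- Pascal on the buffer for the block moment: `Mo_{L'+1}(k) = Mo_{L'}(k) + Mo_{L'}(k-1)` (`k ≥ 1`). -/
theorem Mo_pascal (L' k : ℕ) (hk : 1 ≤ k) :
    ∑ x ∈ range (M + 1), (M.choose x : ℝ) *
        (if x ≤ k then ((L' + 1).choose (k - x) : ℝ) else 0) * w x * (2 * (x : ℝ) - M) =
      (∑ x ∈ range (M + 1), (M.choose x : ℝ) *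
        (if x ≤ k then (L'.choose (k - x) : ℝ) else 0) * w x * (2 * (x : ℝ) - M)) +
      ∑ x ∈ range (M + 1), (M.choose x : ℝ) *
        (if x ≤ k - 1 then (L'.choose (k - 1 - x) : ℝ) else 0) * w x * (2 * (x : ℝ) - M) := by
  have h := CoreBlock.F_pascal M (fun x => w x * (2 * (x : ℝ) - M)) L' k hk
  simp only [← mul_assoc] at h
  exact h

/-- The block moment vanishes at the centre: `Mo(k) = 0` when `2k = M + L` (`w` symmetric). -/
theorem Mo_centre (L : ℕ) (hwsym : ∀ x, x ≤ M → w x = w (M - x)) (k : ℕ) (hk : 2 * k = M + L) :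
    ∑ x ∈ range (M + 1), (M.choose x : ℝ) *
        (if x ≤ k then (L.choose (k - x) : ℝ) else 0) * w x * (2 * (x : ℝ) - M) = 0 := by
  have h := CoreBlock.Mo_odd M L w hwsym k (by omega)
  have e : M + L - k = k := by omega
  rw [e] at h
  linarith

/-- Without buffer (`L = 0`) only `x = h` contributes: `Mo_0(h) = C(M,h) w(h) (2h-M)` for `h ≤ M`. -/
theorem Mo_base (h : ℕ) (hh : h ≤ M) :
    ∑ x ∈ range (M + 1), (M.choose x : ℝ) *
        (if x ≤ h then ((0 : ℕ).choose (h - x) : ℝ) else 0) * w x * (2 * (x : ℝ) - M) =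
      (M.choose h : ℝ) * w h * (2 * (h : ℝ) - M) := by
  rw [sum_eq_single h]
  · simp
  · intro x _ hx
    by_cases hxh : x ≤ h
    · rw [if_pos hxh, Nat.choose_eq_zero_of_lt (show 0 < h - x by omega)]
      simp
    · rw [if_neg hxh]
      simp
  · intro hh'
    exfalso
    exact hh' (mem_range.mpr (by omega))

/-- The coefficient identity of the recursion: with `A = C(n,h)`, `B = C(n,h-1)` (so `h·A = (n+1-h)·B`),
`(n+1)·[(2h-n)A + (2h-n-2)B] = n(2h-n-1)(A+B)`. -/
theorem weight_identity (n h : ℕ) (hh : 1 ≤ h) :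
    ((n : ℝ) + 1) * ((2 * (h : ℝ) - n) * (n.choose h : ℝ) + (2 * (h : ℝ) - n - 2) * (n.choose (h - 1) : ℝ)) =
      (n : ℝ) * (2 * (h : ℝ) - n - 1) * ((n.choose h : ℝ) + (n.choose (h - 1) : ℝ)) := by
  obtain ⟨k, rfl⟩ : ∃ k, h = k + 1 := ⟨h - 1, by omega⟩
  have hrel := Nat.choose_succ_right_eq n k
  -- n.choose (k+1) * (k+1) = n.choose k * (n - k)
  have e : k + 1 - 1 = k := by omega
  rw [e]
  rcases le_or_gt k n with hkn | hkn
  · have hcast : ((n.choose (k + 1) : ℕ) : ℝ) * ((k : ℝ) + 1) = (n.choose k : ℝ) * ((n : ℝ) - k) := by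
      have := congrArg (fun m : ℕ => (m : ℝ)) hrel
      push_cast [Nat.cast_sub hkn] at this
      exact this
    push_cast
    linear_combination (2 : ℝ) * hcast
  · rw [Nat.choose_eq_zero_of_lt hkn, Nat.choose_eq_zero_of_lt (by omega : n < k + 1)]
    push_cast
    ring

/-- **Lemma B1 (Λ-monotonicity).**  For a symmetric unimodal weight `w ≥ 0` and `n = M + L`: for
`n < 2h`, `h + 1 ≤ n`,
`Mo(h+1) / ((2h+2-n) C(n,h+1)) ≤ Mo(h) / ((2h-n) C(n,h))`.
Proof by induction on `L`: for `L = 0`, `Λ(h) = w(h)` and the claim is unimodality; the step uses the Pascal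
recursion `Λ_{L+1}(h) = β(h) Λ_L(h) + α(h) Λ_L(h-1)` whose nonnegative coefficients have the constant sum
`n/(n+1)` (`weight_identity`), so `Λ_{L+1}(h+1) ≤ (n/(n+1)) Λ_L(h) ≤ Λ_{L+1}(h)`. -/
theorem lam_step (hwsym : ∀ x, x ≤ M → w x = w (M - x))
    (hwuni : ∀ x, 2 * x + 2 ≤ M → w x ≤ w (x + 1)) :
    ∀ L h, M + L < 2 * h → h + 1 ≤ M + L →
      (∑ x ∈ range (M + 1), (M.choose x : ℝ) *
          (if x ≤ h + 1 then (L.choose (h + 1 - x) : ℝ) else 0) * w x * (2 * (x : ℝ) - M)) /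
          ((2 * ((h : ℝ) + 1) - ((M : ℝ) + L)) * ((M + L).choose (h + 1) : ℝ)) ≤
      (∑ x ∈ range (M + 1), (M.choose x : ℝ) *
          (if x ≤ h then (L.choose (h - x) : ℝ) else 0) * w x * (2 * (x : ℝ) - M)) /
          ((2 * (h : ℝ) - ((M : ℝ) + L)) * ((M + L).choose h : ℝ)) := by
  intro L
  induction L with
  | zero =>
    intro h hlo hhi
    simp only [Nat.cast_zero, add_zero] at hlo hhi ⊢
    rw [Mo_base M w (h + 1) (by omega), Mo_base M w h (by omega)]
    have hc1 : 0 < (M.choose (h + 1) : ℝ) := by exact_mod_cast Nat.choose_pos (by omega)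
    have hc0 : 0 < (M.choose h : ℝ) := by exact_mod_cast Nat.choose_pos (by omega)
    have hs1 : 0 < 2 * ((h : ℝ) + 1) - M := by
      have : ((M : ℝ)) < 2 * (h : ℝ) := by exact_mod_cast (show (M : ℕ) < 2 * h by omega)
      linarith
    have hs0 : 0 < 2 * (h : ℝ) - M := by
      have : ((M : ℝ)) < 2 * (h : ℝ) := by exact_mod_cast (show (M : ℕ) < 2 * h by omega)
      linarith
    have e1 : (M.choose (h + 1) : ℝ) * w (h + 1) * (2 * (((h + 1 : ℕ) : ℝ)) - M) /
        ((2 * ((h : ℝ) + 1) - M) * (M.choose (h + 1) : ℝ)) = w (h + 1) := by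
      push_cast
      field_simp
    have e0 : (M.choose h : ℝ) * w h * (2 * (h : ℝ) - M) / ((2 * (h : ℝ) - M) * (M.choose h : ℝ)) = w h := by
      field_simp
    rw [e1, e0]
    -- unimodality on the reflected side: w(h+1) = w(M-h-1) ≤ w(M-h) = w(h)
    rw [hwsym (h + 1) (by omega), hwsym h (by omega)]
    have e : M - h = M - (h + 1) + 1 := by omega
    rw [e]
    exact hwuni (M - (h + 1)) (by omega)
  | succ L ih =>
    intro h hlo hhi
    -- notation: n = M + L (the smaller system), V(t) = Mo_L(t) / ((2t-n) C(n,t))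
    have hh1 : 1 ≤ h := by omega
    have hhn : h ≤ M + L := by omega
    set A : ℝ := ((M + L).choose h : ℝ) with hA
    set B : ℝ := ((M + L).choose (h - 1) : ℝ) with hB
    set C' : ℝ := ((M + L).choose (h + 1) : ℝ) with hC'
    set Mo0 : ℝ := ∑ x ∈ range (M + 1), (M.choose x : ℝ) *
        (if x ≤ h then (L.choose (h - x) : ℝ) else 0) * w x * (2 * (x : ℝ) - M) with hMo0
    set Mom : ℝ := ∑ x ∈ range (M + 1), (M.choose x : ℝ) *
        (if x ≤ h - 1 then (L.choose (h - 1 - x) : ℝ) else 0) * w x * (2 * (x : ℝ) - M) with hMom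
    set Mop : ℝ := ∑ x ∈ range (M + 1), (M.choose x : ℝ) *
        (if x ≤ h + 1 then (L.choose (h + 1 - x) : ℝ) else 0) * w x * (2 * (x : ℝ) - M) with hMop
    -- Pascal: Mo_{L+1}(h) = Mo0 + Mom, Mo_{L+1}(h+1) = Mop + Mo0 ; C(n+1,h) = A + B, C(n+1,h+1) = C' + A
    have hP0 := Mo_pascal M w L h hh1
    have hP1 := Mo_pascal M w L (h + 1) (by omega)
    have e1 : h + 1 - 1 = h := by omega
    rw [e1] at hP1
    rw [hP1, hP0]
    have hchoose0 : ((M + (L + 1)).choose h : ℝ) = A + B := by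
      obtain ⟨k, rfl⟩ : ∃ k, h = k + 1 := ⟨h - 1, by omega⟩
      have e : M + (L + 1) = (M + L) + 1 := by omega
      rw [e, Nat.choose_succ_succ', hA, hB]
      push_cast
      ring
    have hchoose1 : ((M + (L + 1)).choose (h + 1) : ℝ) = C' + A := by
      have e : M + (L + 1) = (M + L) + 1 := by omega
      rw [e, Nat.choose_succ_succ', hA, hC']
      push_cast
      ring
    rw [hchoose0, hchoose1]
    -- positivity of the binomials
    have hApos : 0 < A := by
      rw [hA]
      exact_mod_cast Nat.choose_pos hhn
    have hBpos : 0 < B := by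
      rw [hB]
      exact_mod_cast Nat.choose_pos (by omega)
    have hC'nn : 0 ≤ C' := by
      rw [hC']
      positivity
    have hs : ((M : ℝ) + L) + 1 < 2 * (h : ℝ) := by
      have : ((M + L + 1 : ℕ) : ℝ) < ((2 * h : ℕ) : ℝ) := by exact_mod_cast (show M + L + 1 < 2 * h by omega)
      push_cast at this
      linarith
    -- V(h) and the expressions of Mo0, Mom, Mop through V
    set V0 : ℝ := Mo0 / ((2 * (h : ℝ) - ((M : ℝ) + L)) * A) with hV0
    have hMo0V : Mo0 = (2 * (h : ℝ) - ((M : ℝ) + L)) * A * V0 := by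
      have hne1 : (2 * (h : ℝ) - ((M : ℝ) + L)) ≠ 0 := (by linarith : (0 : ℝ) < 2 * (h : ℝ) - ((M : ℝ) + L)).ne'
      have hne2 : A ≠ 0 := hApos.ne'
      rw [hV0]
      field_simp
    -- lower neighbour: either the centre (coefficient 0) or the induction hypothesis applies
    have hlow : (2 * (h : ℝ) - ((M : ℝ) + L) - 2) * B * V0 ≤ Mom := by
      rcases Nat.lt_or_ge (M + L + 2) (2 * h) with hlt | hge
      · -- IH at h-1: V(h) ≤ V(h-1)
        have ih' := ih (h - 1) (by omega) (by omega)
        have e2 : h - 1 + 1 = h := by omega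
        rw [e2] at ih'
        have hcast : ((h - 1 : ℕ) : ℝ) = (h : ℝ) - 1 := by
          rw [Nat.cast_sub hh1]
          simp
        rw [hcast] at ih'
        have hden : 0 < (2 * ((h : ℝ) - 1) - ((M : ℝ) + L)) * B := by
          apply mul_pos _ hBpos
          have : ((M + L + 2 : ℕ) : ℝ) < ((2 * h : ℕ) : ℝ) := by exact_mod_cast hlt
          push_cast at this
          linarith
        have e3 : (2 * ((h : ℝ) - 1 + 1) - ((M : ℝ) + L)) * A = (2 * (h : ℝ) - ((M : ℝ) + L)) * A := by ring
        rw [e3, ← hV0] at ih'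
        -- Mom / den ≥ V0  ⇒  den * V0 ≤ Mom
        have := (le_div_iff₀ hden).mp ih'
        have e4 : (2 * (h : ℝ) - ((M : ℝ) + L) - 2) * B = (2 * ((h : ℝ) - 1) - ((M : ℝ) + L)) * B := by ring
        rw [e4]
        linarith
      · -- 2h = n + 2: h - 1 is the centre, Mom = 0 and the coefficient vanishes
        have hc : 2 * (h - 1) = M + L := by omega
        have hMom0 : Mom = 0 := Mo_centre M w L hwsym (h - 1) hc
        have hcoef : (2 * (h : ℝ) - ((M : ℝ) + L) - 2) = 0 := by
          have : ((2 * h : ℕ) : ℝ) = ((M + L + 2 : ℕ) : ℝ) := by exact_mod_cast (by omega : 2 * h = M + L + 2)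
          push_cast at this
          linarith
        rw [hMom0, hcoef]
        simp
    -- upper neighbour: either beyond the support (C' = 0, Mop = 0) or the induction hypothesis applies
    have hup : Mop ≤ (2 * (h : ℝ) - ((M : ℝ) + L) + 2) * C' * V0 := by
      rcases Nat.lt_or_ge (h + 1) (M + L + 1) with hlt | hge
      · have ih' := ih h (by omega) (by omega)
        have hden : 0 < (2 * ((h : ℝ) + 1) - ((M : ℝ) + L)) * C' := by
          apply mul_pos (by linarith)
          rw [hC']
          exact_mod_cast Nat.choose_pos (by omega)
        rw [← hV0] at ih'
        have := (div_le_iff₀ hden).mp ih'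
        have e4 : (2 * (h : ℝ) - ((M : ℝ) + L) + 2) * C' = (2 * ((h : ℝ) + 1) - ((M : ℝ) + L)) * C' := by ring
        rw [e4]
        linarith
      · -- h + 1 = n + 1
        have hC'0 : C' = 0 := by
          rw [hC']
          exact_mod_cast Nat.choose_eq_zero_of_lt (by omega)
        have hMop0 : Mop = 0 := CoreBlock.Mo_eq_zero_of_lt M L w (h + 1) (by omega)
        rw [hC'0, hMop0]
        simp
    -- the coefficient identities
    have hW0 := weight_identity (M + L) h hh1
    have hW1 := weight_identity (M + L) (h + 1) (by omega)
    rw [e1] at hW1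
    push_cast at hW0 hW1
    rw [← hA, ← hB] at hW0
    rw [← hC', ← hA] at hW1
    -- denominators of the two sides
    have hD0 : 0 < (2 * (h : ℝ) - ((M : ℝ) + ((L + 1 : ℕ) : ℝ))) * (A + B) := by
      push_cast
      apply mul_pos (by linarith) (by linarith)
    have hD1 : 0 < (2 * ((h : ℝ) + 1) - ((M : ℝ) + ((L + 1 : ℕ) : ℝ))) * (C' + A) := by
      push_cast
      apply mul_pos (by linarith) (by linarith)
    rw [div_le_div_iff₀ hD1 hD0]
    push_cast
    -- Mo_{L+1}(h+1) ≤ (n/(n+1)) V0 · D1-factor and Mo_{L+1}(h) ≥ (n/(n+1)) V0 · D0-factor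
    have hupper : Mop + Mo0 ≤ ((M : ℝ) + L) / (((M : ℝ) + L) + 1) * (2 * (h : ℝ) - ((M : ℝ) + L) + 1) * (C' + A) * V0 := by
      have e5 : ((M : ℝ) + L) / (((M : ℝ) + L) + 1) * (2 * (h : ℝ) - ((M : ℝ) + L) + 1) * (C' + A) * V0 =
          ((2 * (h : ℝ) - ((M : ℝ) + L) + 2) * C' + (2 * (h : ℝ) - ((M : ℝ) + L)) * A) * V0 := by
        have hne : ((M : ℝ) + L) + 1 ≠ 0 := by positivity
        rw [div_mul_eq_mul_div, div_mul_eq_mul_div, div_mul_eq_mul_div, div_eq_iff hne]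
        linear_combination (-V0) * hW1
      rw [e5, hMo0V]
      have e6 : ((2 * (h : ℝ) - ((M : ℝ) + L) + 2) * C' + (2 * (h : ℝ) - ((M : ℝ) + L)) * A) * V0 =
          (2 * (h : ℝ) - ((M : ℝ) + L) + 2) * C' * V0 + (2 * (h : ℝ) - ((M : ℝ) + L)) * A * V0 := by ring
      rw [e6]
      linarith [hup]
    have hlower : ((M : ℝ) + L) / (((M : ℝ) + L) + 1) * (2 * (h : ℝ) - ((M : ℝ) + L) - 1) * (A + B) * V0 ≤ Mo0 + Mom := by
      have e5 : ((M : ℝ) + L) / (((M : ℝ) + L) + 1) * (2 * (h : ℝ) - ((M : ℝ) + L) - 1) * (A + B) * V0 =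
          ((2 * (h : ℝ) - ((M : ℝ) + L)) * A + (2 * (h : ℝ) - ((M : ℝ) + L) - 2) * B) * V0 := by
        have hne : ((M : ℝ) + L) + 1 ≠ 0 := by positivity
        rw [div_mul_eq_mul_div, div_mul_eq_mul_div, div_mul_eq_mul_div, div_eq_iff hne]
        linear_combination (-V0) * hW0
      rw [e5, hMo0V]
      have e6 : ((2 * (h : ℝ) - ((M : ℝ) + L)) * A + (2 * (h : ℝ) - ((M : ℝ) + L) - 2) * B) * V0 =
          (2 * (h : ℝ) - ((M : ℝ) + L)) * A * V0 + (2 * (h : ℝ) - ((M : ℝ) + L) - 2) * B * V0 := by ring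
      rw [e6]
      linarith [hlow]
    -- combine: (Mop+Mo0) * D0 ≤ (Mo0+Mom) * D1
    have e6 : (2 * (h : ℝ) - ((M : ℝ) + ((L : ℝ) + 1))) = (2 * (h : ℝ) - ((M : ℝ) + L) - 1) := by ring
    have e7 : (2 * ((h : ℝ) + 1) - ((M : ℝ) + ((L : ℝ) + 1))) = (2 * (h : ℝ) - ((M : ℝ) + L) + 1) := by ring
    rw [e6, e7]
    have hD0' : 0 ≤ (2 * (h : ℝ) - ((M : ℝ) + L) - 1) * (A + B) := by
      apply mul_nonneg (by linarith) (by linarith)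
    have hD1' : 0 ≤ (2 * (h : ℝ) - ((M : ℝ) + L) + 1) * (C' + A) := by
      apply mul_nonneg (by linarith) (by linarith)
    calc (Mop + Mo0) * ((2 * (h : ℝ) - ((M : ℝ) + L) - 1) * (A + B))
        ≤ (((M : ℝ) + L) / (((M : ℝ) + L) + 1) * (2 * (h : ℝ) - ((M : ℝ) + L) + 1) * (C' + A) * V0) *
            ((2 * (h : ℝ) - ((M : ℝ) + L) - 1) * (A + B)) := mul_le_mul_of_nonneg_right hupper hD0'
      _ = (((M : ℝ) + L) / (((M : ℝ) + L) + 1) * (2 * (h : ℝ) - ((M : ℝ) + L) - 1) * (A + B) * V0) *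
            ((2 * (h : ℝ) - ((M : ℝ) + L) + 1) * (C' + A)) := by ring
      _ ≤ (Mo0 + Mom) * ((2 * (h : ℝ) - ((M : ℝ) + L) + 1) * (C' + A)) := mul_le_mul_of_nonneg_right hlower hD1'

end LambdaMono

end Summit.CriticalPhenomena.PercolationContinuityZ3.Theorems
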